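import Literature.NumberTheory.EllipticCurves.PadicSigmaSq
import Literature.NumberTheory.EllipticCurves.SigmaSqDivisionBridgeProofs
import Literature.NumberTheory.EllipticCurves.PadicSeriesEvaluation
import Literature.NumberTheory.EllipticCurves.DescendedFrobeniusKatzRank
import HarnessLib

/-!
# Route `ByReductionTypeAtTwo`, crux `RankOneAtTwoBigImageOddLocal` (item stmt-BirchSwinnertonDyer-23715), line AN62 «♯-height of the
# wild pair», σ₀-LEMMA BLOCK (cell `bsd-f1-sign2`, planner seat `-an` g49; `--supports 23715`, helper): **the coefficient recursion
# and the 2-adic denominator law of `L = log(Σ₀/t²)`** for the NAIVE sigma-squared series `Σ₀` (the even solution of the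
# Mazur–Tate sigma equation with constant `c = 0`)

HONEST FRAMING (D-0036/D-0054): THEOREMS ONLY (no definition, no named fact, no `sorry`, no instance); statements about the formal
group of a Weierstrass model, NOT about `BSDp`; item 23715 stays OPEN; BSD is proved for no curve.  These are the gate-backed forms
of the workfile theorems 50R/50A of `Cruxes/RankOneAtTwoBigImageOddLocal/WildPairHeightAN62.lean` §6 (v1.8, -an g49), stated over
the tree's own typing (`SatisfiesSigmaSqODE`, `sigmaShift`, `formalOmega`, `formalXMulSq`): for `Σ₀ ∈ A⟦t⟧` with `[t²]Σ₀ = 1`, `[t³]Σ₀ = a₁`,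
`SatisfiesSigmaSqODE Σ₀ 0`, and `L` with `S·L′ = S′` (`S = sigmaShift² Σ₀ = Σ₀/t²`; only the hypotheses each statement uses are kept):

* §1 `coeff_two_three_formalOmega_mul_formalXMulSq` — `[z²](ω·z²x) = 0`, `[z³](ω·z²x) = a₃` (any `ℚ`-algebra).
* §2 **`naiveSigmaLog_recursion`** (50R) — `k·l_k = 2ω_k − a₁ω_{k−1} − 2Σ_{m=3}^{k} ω_{k−m}ρ_m/(m−1)` over any `ℚ`-algebra
  (`ω = formalOmega`, `ρ = ω·z²x`).
* §3 **`naiveSigmaLog_denominators_two`** (50A) — over `ℚ₂` with `a₁ = 0`, `a₂, a₃, a₄, a₆ ∈ ℤ₂`: `l₁ = 0`, `l₂ = a₂`, `l₃ = a₃`,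
  `l₄ = a₂²/2 + 5a₄/6`, and `‖l_k‖·2 ≤ 2^{v₂ k + ⌊log₂(k−1)⌋}` for `k ≥ 3` (hence `L` converges on the closed disc `‖t‖ ≤ ½`).
* §4 `padicValNat_add_log_add_three_le` — `v₂ k + ⌊log₂(k−1)⌋ + 3 ≤ k` for `k ≥ 5` (the tail arithmetic used downstream).

PLACEMENT (REF2 v75-add3 ccd6a0549646a9f7): 50R = the Mazur–Stein–Tate recursion [MST06 Thm. 1.3 / Alg. 3.1] for the naive
`σ` (Bernardi 1981 §1, every `p`); the 2-adic denominator law 50A was not found in print («beyond-print yes-small», workfile level).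
References: [cite: MazurSteinTate2006, Thm. 1.3, Alg. 3.1, Rem. 1.4] [cite: Bernardi1981, §1] [cite: SilvermanAEC2009, IV.1.1, IV.4.2]
[cite: Wuthrich2004, Prop. 2].
-/

set_option autoImplicit false

noncomputable section

open scoped Classical

open PowerSeries WeierstrassCurve Literature.NumberTheory.EllipticCurves

namespace Summit.BirchSwinnertonDyer.BirchSwinnertonDyer.Theorems

namespace NaiveSigmaLogAtTwo

/-! ### §1 The residues `[z²], [z³]` of `η = ω·z²x` -/

/-- **`[z²](ω/dz · z²x) = 0` and `[z³](ω/dz · z²x) = a₃`** over any `ℚ`-algebra (`ω/dz = 1 + a₁z + (a₁² + a₂)z² +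
(a₁³ + 2a₁a₂ + 2a₃)z³ + ⋯`, `z²x = 1 − a₁z − a₂z² − a₃z³ − ⋯`): the residue of `η = xω` vanishes one order further than
`coeff_one_formalXMulSq_mul_formalOmega`, and the first non-trivial Katz coefficient is `g₁ = a₃`.
[cite: SilvermanAEC2009, IV.1.1] [cite: Katz1981CrysCohDieudonne, §5 Lemma 5.1.2] -/
theorem coeff_two_three_formalOmega_mul_formalXMulSq {A : Type*} [CommRing A] [Algebra ℚ A] (V : WeierstrassCurve A) :
    coeff 2 (V.formalOmega * V.formalXMulSq) = 0 ∧ coeff 3 (V.formalOmega * V.formalXMulSq) = V.a₃ := by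
  obtain ⟨hT2, hT3, -⟩ :=
    Literature.NumberTheory.EllipticCurves.DescendedFrobenius.NineClassesIndependent.coeff_formalXMulSq_two_three_four V
  have hT0 : coeff 0 V.formalXMulSq = 1 := by rw [coeff_zero_eq_constantCoeff]; exact V.constantCoeff_formalXMulSq
  have hT1 := V.coeff_one_formalXMulSq
  have hω0 : coeff 0 V.formalOmega = 1 := by rw [coeff_zero_eq_constantCoeff]; exact V.constantCoeff_formalOmega
  have hω1 := Literature.NumberTheory.EllipticCurves.DescendedFrobenius.FormalGroupCoefficients.coeff_one_formalOmega V
  have hω2 := Literature.NumberTheory.EllipticCurves.DescendedFrobenius.FormalGroupCoefficients.coeff_two_formalOmega V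
  have hω3 := Literature.NumberTheory.EllipticCurves.DescendedFrobenius.FormalGroupCoefficients.coeff_three_formalOmega V
  refine ⟨?_, ?_⟩
  · rw [PowerSeries.coeff_mul, Finset.Nat.sum_antidiagonal_succ, Finset.Nat.sum_antidiagonal_succ]
    simp only [Finset.Nat.antidiagonal_zero, Finset.sum_singleton, zero_add, hT0, hT1, hT2, hω0, hω1, hω2]
    ring
  · rw [PowerSeries.coeff_mul, Finset.Nat.sum_antidiagonal_succ, Finset.Nat.sum_antidiagonal_succ,
      Finset.Nat.sum_antidiagonal_succ]
    simp only [Finset.Nat.antidiagonal_zero, Finset.sum_singleton, zero_add, hT0, hT1, hT2, hT3, hω0, hω1, hω2, hω3]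
    ring

/-! ### §2 50R — the coefficient recursion of `L = log(Σ₀/t²)` -/

/-- **50R `naiveSigmaLog_recursion`** (kernel): the coefficient recursion of `L = log(Σ₀/t²)`.  Proof: with `S := Σ₀/t²` (a unit) and
`G := sigmaSqG Σ₀ = (2S + tS′)·(ωS)⁻¹` one has `ω·G = 2 + t·L′` (cancel the unit `S`, using `S·L′ = S′`), so
`[t^{j+1}](ωG) = (j+1)·l_{j+1}`; the ODE `2ωρ = G − tG′` reads `n·g_{n+1} = −2ρ_{n+1}`; `g₀ = 2`, `g₁ = −a₁`, `g₂ = 0`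
(`ρ₁ = ρ₂ = 0`), `g_m = −2ρ_m/(m−1)` (`m ≥ 3`); expand `[t^k](ω·G)` by `coeff_mul` and split the range at `3`.
[cite: MazurSteinTate2006, Thm. 1.3] [cite: SilvermanAEC2009, IV.1.1] -/
theorem naiveSigmaLog_recursion (A : Type*) [CommRing A] [Algebra ℚ A] (W : WeierstrassCurve A) (Sq L : A⟦X⟧)
    (h2 : coeff 2 Sq = 1) (h3 : coeff 3 Sq = W.a₁) (hODE : W.SatisfiesSigmaSqODE Sq 0)
    (hL : sigmaShift (sigmaShift Sq) * d⁄dX A L = d⁄dX A (sigmaShift (sigmaShift Sq))) (k : ℕ) (hk : 1 ≤ k) :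
    (k : A) * coeff k L =
      2 * coeff k W.formalOmega - W.a₁ * coeff (k - 1) W.formalOmega -
        2 * ∑ m ∈ Finset.Icc 3 k,
          coeff (k - m) W.formalOmega * coeff m (W.formalOmega * W.formalXMulSq) * algebraMap ℚ A (((m : ℚ) - 1)⁻¹) := by
  -- the helper coefficient `ρ₂ = 0`
  obtain ⟨hP2, -⟩ := coeff_two_three_formalOmega_mul_formalXMulSq W
  -- `S = Σ₀/t²`, `S(0) = 1`, `[t]S = a₁`
  set S : A⟦X⟧ := sigmaShift (sigmaShift Sq) with hS
  have hS0 : constantCoeff S = 1 := by rw [hS, constantCoeff_sigmaShift, coeff_sigmaShift, h2]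
  have hS1 : coeff 1 S = W.a₁ := by rw [hS, coeff_sigmaShift, coeff_sigmaShift, h3]
  -- `G := sigmaSqG Σ₀`, `G·(ωS) = 2S + tS'`
  set G : A⟦X⟧ := W.sigmaSqG Sq with hG
  have hU0 : constantCoeff (W.formalOmega * S) = 1 := by
    rw [map_mul, W.constantCoeff_formalOmega, hS0, one_mul]
  have hGmul : G * (W.formalOmega * S) = 2 * S + X * d⁄dX A S := by
    rw [hG, WeierstrassCurve.sigmaSqG, ← hS, mul_assoc, mul_comm (invOfUnit _ _),
      mul_invOfUnit _ _ (by rw [hU0, Units.val_one]), mul_one]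
  -- (E1) `ω·G = 2 + t·L'` (cancel the unit `S`)
  have hSinv : S * invOfUnit S 1 = 1 := mul_invOfUnit S 1 (by rw [hS0, Units.val_one])
  have hkey : S * (W.formalOmega * G) = S * (2 + X * d⁄dX A L) := by
    calc S * (W.formalOmega * G) = G * (W.formalOmega * S) := by ring
      _ = 2 * S + X * d⁄dX A S := hGmul
      _ = 2 * S + X * (S * d⁄dX A L) := by rw [hL]
      _ = S * (2 + X * d⁄dX A L) := by ring
  have E1 : W.formalOmega * G = 2 + X * d⁄dX A L := by
    calc W.formalOmega * G = (S * invOfUnit S 1) * (W.formalOmega * G) := by rw [hSinv, one_mul]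
      _ = invOfUnit S 1 * (S * (W.formalOmega * G)) := by ring
      _ = invOfUnit S 1 * (S * (2 + X * d⁄dX A L)) := by rw [hkey]
      _ = (S * invOfUnit S 1) * (2 + X * d⁄dX A L) := by ring
      _ = 2 + X * d⁄dX A L := by rw [hSinv, one_mul]
  -- (E2) the ODE with constant `0`: `2·(ω·z²x) = G − t·G'`
  have E2 : 2 * (W.formalOmega * W.formalXMulSq) = G - X * d⁄dX A G := by
    have h := hODE
    rw [WeierstrassCurve.SatisfiesSigmaSqODE, map_zero, zero_mul, add_zero] at h
    rw [hG]
    exact h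
  have h2C : (2 : A⟦X⟧) = C (2 : A) := (map_ofNat C 2).symm
  -- coefficients of (E2): `n·g_{n+1} = −2ρ_{n+1}`
  have hrec : ∀ n : ℕ, (n : A) * coeff (n + 1) G = -2 * coeff (n + 1) (W.formalOmega * W.formalXMulSq) := by
    intro n
    have h := congrArg (coeff (n + 1)) E2
    rw [h2C, coeff_C_mul, map_sub, coeff_succ_X_mul, coeff_derivative] at h
    linear_combination h
  -- coefficients of (E1): `[t^{j+1}](ωG) = (j+1)·l_{j+1}`
  have hE1coeff : ∀ j : ℕ, coeff (j + 1) (W.formalOmega * G) = ((j : A) + 1) * coeff (j + 1) L := by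
    intro j
    rw [E1, map_add, coeff_succ_X_mul, coeff_derivative, h2C, coeff_C, if_neg (Nat.succ_ne_zero j), zero_add]
    ring
  -- `g₀ = 2`
  have hg0 : coeff 0 G = 2 := by
    have h := congrArg constantCoeff E1
    rw [map_mul, W.constantCoeff_formalOmega, one_mul, map_add, map_mul, constantCoeff_X, zero_mul, add_zero,
      h2C, constantCoeff_C] at h
    rw [coeff_zero_eq_constantCoeff_apply, h]
  -- `l₁ = a₁`
  have hl1 : coeff 1 L = W.a₁ := by
    have h := congrArg constantCoeff hL
    rw [map_mul, hS0, one_mul, constantCoeff_derivative, constantCoeff_derivative, hS1] at h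
    exact h
  -- `g₁ = −a₁`
  have hω0 : coeff 0 W.formalOmega = 1 := by rw [coeff_zero_eq_constantCoeff]; exact W.constantCoeff_formalOmega
  have hω1 := Literature.NumberTheory.EllipticCurves.DescendedFrobenius.FormalGroupCoefficients.coeff_one_formalOmega W
  have hg1 : coeff 1 G = -W.a₁ := by
    have h := hE1coeff 0
    rw [zero_add, coeff_one_mul_eq, hω0, hω1, hg0, Nat.cast_zero, zero_add, one_mul, hl1] at h
    linear_combination h
  -- `g₂ = 0`
  have hg2 : coeff 2 G = 0 := by
    have h := hrec 1
    rw [Nat.cast_one, one_mul, show (1 : ℕ) + 1 = 2 from rfl, hP2, mul_zero] at h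
    exact h
  -- `g_m = −2ρ_m/(m−1)` for `m ≥ 3`
  have hg3 : ∀ m : ℕ, 3 ≤ m →
      coeff m G = -2 * coeff m (W.formalOmega * W.formalXMulSq) * algebraMap ℚ A (((m : ℚ) - 1)⁻¹) := by
    intro m hm
    obtain ⟨n, rfl⟩ : ∃ n, m = n + 1 := ⟨m - 1, by omega⟩
    have hn : (n : ℚ) ≠ 0 := Nat.cast_ne_zero.mpr (by omega)
    have hcast : (((n + 1 : ℕ) : ℚ) - 1) = n := by push_cast; ring
    rw [hcast]
    have hunit : (n : A) * algebraMap ℚ A ((n : ℚ)⁻¹) = 1 := by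
      rw [← map_natCast (algebraMap ℚ A) n, ← map_mul, mul_inv_cancel₀ hn, map_one]
    calc coeff (n + 1) G = coeff (n + 1) G * ((n : A) * algebraMap ℚ A ((n : ℚ)⁻¹)) := by rw [hunit, mul_one]
      _ = ((n : A) * coeff (n + 1) G) * algebraMap ℚ A ((n : ℚ)⁻¹) := by ring
      _ = -2 * coeff (n + 1) (W.formalOmega * W.formalXMulSq) * algebraMap ℚ A ((n : ℚ)⁻¹) := by rw [hrec n]
  -- the convolution `k·l_k = Σ_{i ≤ k} g_i ω_{k−i}`
  have hconv : ∀ j : ℕ, (((j + 1 : ℕ) : A)) * coeff (j + 1) L =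
      ∑ i ∈ Finset.range (j + 2), coeff i G * coeff (j + 1 - i) W.formalOmega := by
    intro j
    push_cast
    rw [← hE1coeff j, mul_comm W.formalOmega G, coeff_mul, Finset.Nat.sum_antidiagonal_eq_sum_range_succ_mk]
  obtain ⟨j, rfl⟩ : ∃ j, k = j + 1 := ⟨k - 1, by omega⟩
  rw [hconv j]
  rcases Nat.lt_or_ge j 1 with hj | hj
  · -- `k = 1`
    obtain rfl : j = 0 := by omega
    rw [Finset.sum_range_succ, Finset.sum_range_succ, Finset.sum_range_zero, zero_add, hg0, hg1,
      show Finset.Icc 3 (0 + 1) = ∅ from rfl, Finset.sum_empty, mul_zero, sub_zero]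
    ring
  · -- `k ≥ 2`: split the range at `3`
    have hsplit := Finset.sum_Ico_consecutive (fun i => coeff i G * coeff (j + 1 - i) W.formalOmega)
      (Nat.zero_le 3) (show 3 ≤ j + 2 by omega)
    rw [Nat.Ico_zero_eq_range, Nat.Ico_zero_eq_range, show j + 2 = (j + 1) + 1 from rfl,
      Finset.Ico_add_one_right_eq_Icc] at hsplit
    rw [← hsplit, Finset.sum_range_succ, Finset.sum_range_succ, Finset.sum_range_succ, Finset.sum_range_zero,
      zero_add, hg0, hg1, hg2, zero_mul, add_zero]
    have hsum : ∑ m ∈ Finset.Icc 3 (j + 1), coeff m G * coeff (j + 1 - m) W.formalOmega =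
        -(2 * ∑ m ∈ Finset.Icc 3 (j + 1), coeff (j + 1 - m) W.formalOmega *
          coeff m (W.formalOmega * W.formalXMulSq) * algebraMap ℚ A (((m : ℚ) - 1)⁻¹)) := by
      rw [Finset.mul_sum, ← Finset.sum_neg_distrib]
      refine Finset.sum_congr rfl fun m hm => ?_
      rw [hg3 m (Finset.mem_Icc.mp hm).1]
      ring
    rw [hsum, show j + 1 - 0 = j + 1 from rfl, show j + 1 - 1 = j from rfl]
    ring

/-! ### §3 50A — the 2-adic denominator law -/

/-- **50A `naiveSigmaLog_denominators_two`** (kernel): the σ₀-lemma at `2`.  Proof: 50R at `A = ℚ₂`, `a₁ = 0`; the four low coefficients from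
`ω = 1 + a₂t² + 2a₃t³ + (a₂² + 2a₄)t⁴ + ⋯`, `ρ₃ = a₃`, `ρ₄ = a₂² + 2a₄` (`a₁ = 0`); the bound from `ω_j, ρ_m ∈ ℤ₂`
(`IsIntegral ℤ₂` by the norm hypotheses, `isPadicInt_formalOmega/formalXMulSq`), the ultrametric inequality for the sum, and
`‖(m−1)⁻¹‖ = 2^{v₂(m−1)} ≤ 2^{⌊log₂(k−1)⌋}` (`padicValNat_le_nat_log`), `‖k⁻¹‖ = 2^{v₂ k}`.
[cite: SilvermanAEC2009, IV.1.1, IV.4.2] [cite: Bernardi1981, §1] -/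
theorem naiveSigmaLog_denominators_two (W : WeierstrassCurve ℚ_[2]) (Sq L : ℚ_[2]⟦X⟧)
    (ha1 : W.a₁ = 0) (ha2 : ‖W.a₂‖ ≤ 1) (ha3 : ‖W.a₃‖ ≤ 1) (ha4 : ‖W.a₄‖ ≤ 1) (ha6 : ‖W.a₆‖ ≤ 1)
    (h2 : coeff 2 Sq = 1) (h3 : coeff 3 Sq = 0) (hODE : W.SatisfiesSigmaSqODE Sq 0)
    (hL : sigmaShift (sigmaShift Sq) * d⁄dX ℚ_[2] L = d⁄dX ℚ_[2] (sigmaShift (sigmaShift Sq))) :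
    coeff 1 L = 0 ∧ coeff 2 L = W.a₂ ∧ coeff 3 L = W.a₃ ∧ coeff 4 L = W.a₂ ^ 2 / 2 + 5 * W.a₄ / 6 ∧
    ∀ k : ℕ, 3 ≤ k → ‖coeff k L‖ * 2 ≤ 2 ^ (padicValNat 2 k + Nat.log 2 (k - 1)) := by
  have hR := naiveSigmaLog_recursion ℚ_[2] W Sq L h2 (by rw [h3, ha1]) hODE hL
  -- the recursion at `a₁ = 0`, with `algebraMap ℚ ℚ₂ ((m−1)⁻¹) = ((m : ℚ₂) − 1)⁻¹`
  have hc : ∀ m : ℕ, algebraMap ℚ ℚ_[2] (((m : ℚ) - 1)⁻¹) = ((m : ℚ_[2]) - 1)⁻¹ := fun m => by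
    rw [map_inv₀, map_sub, map_natCast, map_one]
  have hR' : ∀ k : ℕ, 1 ≤ k → (k : ℚ_[2]) * coeff k L =
      2 * coeff k W.formalOmega - 2 * ∑ m ∈ Finset.Icc 3 k,
        coeff (k - m) W.formalOmega * coeff m (W.formalOmega * W.formalXMulSq) * (((m : ℚ_[2]) - 1)⁻¹) := by
    intro k hk
    have h := hR k hk
    simp only [hc, ha1, zero_mul, sub_zero] at h
    exact h
  -- low coefficients of `ω` and `ρ = ω·z²x` at `a₁ = 0`
  have hω0 : coeff 0 W.formalOmega = 1 := by rw [coeff_zero_eq_constantCoeff]; exact W.constantCoeff_formalOmega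
  have hω1 : coeff 1 W.formalOmega = 0 := by
    rw [Literature.NumberTheory.EllipticCurves.DescendedFrobenius.FormalGroupCoefficients.coeff_one_formalOmega, ha1]
  have hω2 : coeff 2 W.formalOmega = W.a₂ := by
    rw [Literature.NumberTheory.EllipticCurves.DescendedFrobenius.FormalGroupCoefficients.coeff_two_formalOmega, ha1]
    ring
  have hω3 : coeff 3 W.formalOmega = 2 * W.a₃ := by
    rw [Literature.NumberTheory.EllipticCurves.DescendedFrobenius.FormalGroupCoefficients.coeff_three_formalOmega, ha1]
    ring
  have hω4 : coeff 4 W.formalOmega = W.a₂ ^ 2 + 2 * W.a₄ := by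
    rw [Literature.NumberTheory.EllipticCurves.DescendedFrobenius.FormalGroupCoefficients.coeff_four_formalOmega, ha1]
    ring
  obtain ⟨-, hP3⟩ := coeff_two_three_formalOmega_mul_formalXMulSq W
  have hP4 : coeff 4 (W.formalOmega * W.formalXMulSq) = W.a₄ := by
    rw [mul_comm,
      Literature.NumberTheory.EllipticCurves.DescendedFrobenius.NineClassesIndependent.coeff_four_formalXMulSq_mul_formalOmega,
      ha1]
    ring
  -- (i)–(iv)
  have e1 := hR' 1 le_rfl
  rw [Nat.cast_one, one_mul, hω1, show Finset.Icc 3 1 = ∅ from rfl, Finset.sum_empty] at e1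
  have e2 := hR' 2 (by norm_num)
  rw [hω2, show Finset.Icc 3 2 = ∅ from rfl, Finset.sum_empty] at e2
  push_cast at e2
  have e3 := hR' 3 (by norm_num)
  rw [hω3, Finset.Icc_self, Finset.sum_singleton, show 3 - 3 = 0 from rfl, hω0, hP3] at e3
  push_cast at e3
  norm_num at e3
  have e4 := hR' 4 (by norm_num)
  rw [hω4, (by decide : Finset.Icc 3 4 = {3, 4}), Finset.sum_pair (by decide), show 4 - 3 = 1 from rfl,
    show 4 - 4 = 0 from rfl, hω1, hω0, hP3, hP4] at e4
  push_cast at e4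
  norm_num at e4
  refine ⟨by linear_combination e1, by linear_combination (1 / 2 : ℚ_[2]) * e2,
    by linear_combination (1 / 3 : ℚ_[2]) * e3, by linear_combination (1 / 4 : ℚ_[2]) * e4, ?_⟩
  -- (v) the denominator bound
  intro k hk
  haveI : W.IsIntegral ℤ_[2] := isIntegral_of_exists_lift ℤ_[2] ⟨0, by rw [map_zero, ha1]⟩
    ⟨⟨W.a₂, ha2⟩, rfl⟩ ⟨⟨W.a₃, ha3⟩, rfl⟩ ⟨⟨W.a₄, ha4⟩, rfl⟩ ⟨⟨W.a₆, ha6⟩, rfl⟩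
  have hωint : ∀ j, ‖coeff j W.formalOmega‖ ≤ 1 := fun j => isPadicInt_iff_coeff.mp W.isPadicInt_formalOmega j
  have hρint : ∀ j, ‖coeff j (W.formalOmega * W.formalXMulSq)‖ ≤ 1 := fun j =>
    isPadicInt_iff_coeff.mp (W.isPadicInt_formalOmega.mul W.isPadicInt_formalXMulSq) j
  have hnorm_inv : ∀ n : ℕ, 0 < n → ‖((n : ℚ_[2]))⁻¹‖ = (2 : ℝ) ^ padicValNat 2 n := by
    intro n hn
    have hn' : (n : ℚ_[2]) ≠ 0 := Nat.cast_ne_zero.mpr hn.ne'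
    rw [norm_inv, Padic.norm_eq_zpow_neg_valuation hn', Padic.valuation_natCast, zpow_neg, inv_inv, zpow_natCast]
    norm_num
  have h2 : ‖(2 : ℚ_[2])‖ = 2⁻¹ := by exact_mod_cast (Padic.norm_p (p := 2))
  set B : ℝ := (2 : ℝ) ^ Nat.log 2 (k - 1) with hB
  have hB1 : 1 ≤ B := one_le_pow₀ (by norm_num)
  set T : ℚ_[2] := coeff k W.formalOmega - ∑ m ∈ Finset.Icc 3 k,
    coeff (k - m) W.formalOmega * coeff m (W.formalOmega * W.formalXMulSq) * (((m : ℚ_[2]) - 1)⁻¹) with hT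
  have hTle : ‖T‖ ≤ B := by
    rw [hT, sub_eq_add_neg]
    refine (IsUltrametricDist.norm_add_le_max _ _).trans (max_le ((hωint k).trans hB1) ?_)
    rw [norm_neg]
    refine IsUltrametricDist.norm_sum_le_of_forall_le_of_nonneg (by positivity) fun m hm => ?_
    obtain ⟨hm3, hmk⟩ := Finset.mem_Icc.mp hm
    rw [norm_mul, norm_mul, show ((m : ℚ_[2]) - 1) = ((m - 1 : ℕ) : ℚ_[2]) by push_cast [Nat.cast_sub (by omega : 1 ≤ m)]; ring,
      hnorm_inv (m - 1) (by omega)]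
    have hv : padicValNat 2 (m - 1) ≤ Nat.log 2 (k - 1) :=
      (padicValNat_le_nat_log _).trans (Nat.log_mono_right (by omega))
    calc ‖coeff (k - m) W.formalOmega‖ * ‖coeff m (W.formalOmega * W.formalXMulSq)‖ * (2 : ℝ) ^ padicValNat 2 (m - 1)
        ≤ 1 * 1 * B := by
          gcongr
          · exact hωint _
          · exact hρint _
          · exact pow_le_pow_right₀ (by norm_num) hv
      _ = B := by ring
  have hk0 : (k : ℚ_[2]) ≠ 0 := Nat.cast_ne_zero.mpr (by omega)
  have e := hR' k (by omega)
  have hl : coeff k L = ((k : ℚ_[2]))⁻¹ * (2 * T) := by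
    rw [eq_inv_mul_iff_mul_eq₀ hk0, e, hT]
    ring
  rw [hl, norm_mul, norm_mul, hnorm_inv k (by omega), h2, pow_add, ← hB]
  calc (2 : ℝ) ^ padicValNat 2 k * (2⁻¹ * ‖T‖) * 2 = 2 ^ padicValNat 2 k * ‖T‖ := by ring
    _ ≤ 2 ^ padicValNat 2 k * B := by gcongr

/-! ### §4 Tail arithmetic -/

/-- The arithmetic of the exponent: `v₂(k) + ⌊log₂(k−1)⌋ + 3 ≤ k` for `k ≥ 5`. -/
theorem padicValNat_add_log_add_three_le {k : ℕ} (hk : 5 ≤ k) :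
    padicValNat 2 k + Nat.log 2 (k - 1) + 3 ≤ k := by
  by_cases hk10 : 10 ≤ k
  · have hv : padicValNat 2 k ≤ Nat.log 2 k := padicValNat_le_nat_log k
    have hl : Nat.log 2 (k - 1) ≤ Nat.log 2 k := Nat.log_mono_right (Nat.sub_le k 1)
    have hpow : 2 ^ Nat.log 2 k ≤ k := Nat.pow_log_le_self 2 (by omega)
    by_cases hL : Nat.log 2 k ≤ 3
    · omega
    · have key : ∀ L : ℕ, 4 ≤ L → 2 * L + 3 ≤ 2 ^ L := by
        intro L hL
        induction L, hL using Nat.le_induction with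
        | base => decide
        | succ L hL ih => rw [pow_succ]; omega
      have h2 := key (Nat.log 2 k) (by omega)
      omega
  · have hv : ∀ n e : ℕ, n ≠ 0 → ¬ 2 ^ e ∣ n → padicValNat 2 n < e := by
      intro n e hn hdvd
      rw [← not_le]
      intro h
      exact hdvd ((Nat.pow_dvd_iff_le_padicValNat (by decide) hn).mpr h)
    have h5 := hv 5 1 (by decide) (by decide)
    have h6 := hv 6 2 (by decide) (by decide)
    have h7 := hv 7 1 (by decide) (by decide)
    have h8 := hv 8 4 (by decide) (by decide)
    have h9 := hv 9 1 (by decide) (by decide)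
    have l4 : Nat.log 2 4 < 3 := Nat.log_lt_of_lt_pow (by decide) (by decide)
    have l5 : Nat.log 2 5 < 3 := Nat.log_lt_of_lt_pow (by decide) (by decide)
    have l6 : Nat.log 2 6 < 3 := Nat.log_lt_of_lt_pow (by decide) (by decide)
    have l7 : Nat.log 2 7 < 3 := Nat.log_lt_of_lt_pow (by decide) (by decide)
    have l8 : Nat.log 2 8 < 4 := Nat.log_lt_of_lt_pow (by decide) (by decide)
    interval_cases k <;> simp only [Nat.reduceSub] <;> omega

end NaiveSigmaLogAtTwo

end Summit.BirchSwinnertonDyer.BirchSwinnertonDyer.Theorems
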